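import Summits.AnomalousDissipation.AnomalousDissipation.Theorems.SolenoidalFractalHomogenisationLagrangianStepClassReduction
import Summits.AnomalousDissipation.AnomalousDissipation.Theorems.SolenoidalFractalHomogenisationLagrangianStepOneLevelSplitDefsW7Frame
import Summits.AnomalousDissipation.AnomalousDissipation.Theorems.SolenoidalFractalHomogenisationLagrangianStepW7ThreeModeFibreR
import Literature.Analysis.FluidPDE.PassiveVectorTensorDistortedConstFrameSymmetry
import Literature.Analysis.FluidPDE.PassiveVectorTensorDistortedConstFrameUniqueness
import HarnessLib

/-!
# K1L_D (stmt-AnomalousDissipation-27980), (ℓ3) (D-TH)₀ — PER-CLASS (conjugate-pair) REDUCTION of the graded frozen-frame high-label decay clause: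
# `(∀ G₀, |G₀ − 1| ≤ θW → ClassDecayWθ G₀ … admAll) → HighLabelDecayWthg … θW` under `0 < lo`, `0 ≤ θW < 1/3`
# (helper; `--supports stmt-AnomalousDissipation-27980 --as helper`)

Port plan B12 (`HOME/ad-sawtooth-k1loc-p1/g16/W7thg-portplan-k1locp1g16.md`; prover ad-sawtooth-k1loc-p1 g16): the frozen-frame twin of w1 g3's
`classReduction_of_pos` (`…ClassReduction`).  The isotypic pair-projection argument is unchanged — §1–§3 of the flat file (multipliers, classes,
`R_c v = Σ_j n⁻³cos(2πc·j/n) v(· + j/n)`, support, Parseval re-assembly `integral_norm_sq_eq_sum_classes`) are field-level facts reused BY NAME; what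
changes is the solution class: at a CONSTANT frame `G₀` the distorted cell problem is still invariant under the grid translations (the frame does not see
`x`), so `R_c` maps distorted weak solutions to distorted weak solutions (Literature `IsWeakTensorPassiveVectorDistortedOn.sum_smul_translate_constFrame'`,
p728773), the twisted datum constraint `∇·(G₀F) = 0` is preserved (`distort_const_sum_smul_translate` + `isWeaklyDivFree_sum_smul_translate`), and the near
classes (no datum) are killed by the constant-frame uniqueness theorem `ae_eq_zero_of_memLp_top_constFrame` (frame non-degeneracy `c₀ = (1 − 3θW)² > 0`,
`le_freqNormSq_twist`, whence the binder `θW < 1/3`).  The determinant hypothesis of `HighLabelDecayWthg` is not used.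
* `distort_const_sum_smul_translate`, `isWeaklyDivFree_distort_pairProj`;
* **`classReductionFrame_of_pos`**.
No named facts, no new definitions, no sorry.  NOT a proof of `stub_W7thg` (next file), of K1L_D or of AD; rung F-D1.A0.
[cite: KhaKuchment2021, §1.1–§1.2 (G-periodic operators / Floquet–Bloch sectors)] [problem: turb]
-/

set_option linter.dupNamespace false

noncomputable section

namespace Summit.AnomalousDissipation.AnomalousDissipation.Theorems.SolenoidalFractalHomogenisation.LagrangianStep

open Literature.Analysis Literature.Analysis.FluidPDE Literature.Analysis.FunctionSpaces
open MeasureTheory Set Filter Function UnitAddTorus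
open scoped ENNReal NNReal InnerProductSpace
open Summit.AnomalousDissipation.AnomalousDissipation.Theorems.SolenoidalFractalHomogenisation.RealisedQuasiStaticCellLaw
  (memLp_two_of_memSobolev_one_complexify memLp_top_stLift_cell)
open Summit.AnomalousDissipation.AnomalousDissipation.Theorems.SolenoidalFractalHomogenisation.LagrangianStep.ThreeMode (le_freqNormSq_twist)

namespace ClassReduction

variable {n : ℕ}

/-- A constant distortion commutes with finite superpositions of translates:
`G₀·(Σ_i c_i • v(· + g_i)) = Σ_i c_i • (G₀·v)(· + g_i)`. [cite: ArmstrongVicol2025, §4.1 (PDF p. 34)] -/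
theorem distort_const_sum_smul_translate {ι : Type*} [Fintype ι] (G₀ : Matrix (Fin 3) (Fin 3) ℝ) (g : ι → UnitAddTorus (Fin 3)) (c : ι → ℝ)
    (v : VF) :
    Torus.distort (fun _ => G₀) (fun x => ∑ i, c i • v (x + g i)) = fun x => ∑ i, c i • Torus.distort (fun _ => G₀) v (x + g i) := by
  funext y
  ext a
  rw [Torus.distort_apply]
  simp only [WithLp.ofLp_sum, WithLp.ofLp_smul, Finset.sum_apply, Pi.smul_apply, smul_eq_mul, Torus.distort_apply,
    Finset.mul_sum]
  rw [Finset.sum_comm]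
  exact Finset.sum_congr rfl fun i _ => Finset.sum_congr rfl fun b _ => by ring

/-- The pair projection preserves the TWISTED divergence constraint `∇·(G₀ F) = 0` (constant frame). [cite: ArmstrongVicol2025, §4.1 (PDF p. 34)] -/
theorem isWeaklyDivFree_distort_pairProj (hn : 0 < n) (G₀ : Matrix (Fin 3) (Fin 3) ℝ) (ℓ : Fin 3 → ℤ) {F : VF} (hFi : Integrable F volume)
    (hdiv : FunctionSpaces.Torus.IsWeaklyDivFree (Torus.distort (fun _ => G₀) F)) :
    FunctionSpaces.Torus.IsWeaklyDivFree (Torus.distort (fun _ => G₀)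
      (fun x => ∑ j : Fin 3 → Fin n, (1 / (n:ℝ) ^ 3 * Real.cos (2 * Real.pi * (∑ i, (ℓ i : ℝ) * ((j i : ℕ) : ℝ)) / n)) • F (x + (fun i => ((((j i : ℕ) : ℝ) / n : ℝ) : UnitAddCircle))))) := by
  have _ := hn
  rw [distort_const_sum_smul_translate]
  exact isWeaklyDivFree_sum_smul_translate _ _ hdiv (Torus.integrable_distort_const' G₀ hFi)

end ClassReduction

open ClassReduction in
/-- **PER-CLASS REDUCTION of the graded frozen-frame high-label decay clause** (`0 < lo`, `0 ≤ θW < 1/3`):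
`(∀ G₀, |G₀ − 1| ≤ θW → ClassDecayWθ G₀ W M hM lo hi Λ β ν₀ Kb CK cK admAll) → HighLabelDecayWthg W M hM lo hi Λ β ν₀ Kb CK cK θW`.
Proof: decompose any distorted weak cell solution `u` into the real character averages `R_c u` (`sum_smul_translate_constFrame'` along the grid-invariant
cell carrier — the constant frame is translation invariant), apply `ClassDecayWθ G₀` on the far classes, kill the near classes (no datum,
`pairProj_ae_eq_zero_of_near` + constant-frame uniqueness `ae_eq_zero_of_memLp_top_constFrame` with `c₀ = (1 − 3θW)²`), and re-assemble by Parseval with the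
weights `β_c ∈ {1,2}` (`integral_norm_sq_eq_sum_classes`). [cite: KhaKuchment2021, §1.1–§1.2 (G-periodic operators / Floquet–Bloch sectors)] -/
theorem classReductionFrame_of_pos {k : ℕ} (W : LatticeShear.LatticeWord k) (M : ℝ) (hM : 0 < M) (lo hi Λ β ν₀ Kb CK cK θW : ℝ) (hlo : 0 < lo)
    (hθW0 : 0 ≤ θW) (hθW3 : θW < 1 / 3)
    (hC : ∀ G₀ : Matrix (Fin 3) (Fin 3) ℝ, (∀ i j, |G₀ i j - (1 : Matrix (Fin 3) (Fin 3) ℝ) i j| ≤ θW) →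
      ClassDecayWθ G₀ W M hM lo hi Λ β ν₀ Kb CK cK admAll) :
    HighLabelDecayWthg W M hM lo hi Λ β ν₀ Kb CK cK θW := by
  intro θ hθ G₀ _hdet hG ν hν n hn 𝔸 hodd hwin L hL hKL F hF1 hF0 hFdiv hsupp T hT u hu
  have hG' : ∀ i j, |G₀ i j - (1 : Matrix (Fin 3) (Fin 3) ℝ) i j| ≤ θW := fun i j => (hG i j).trans hθ.2
  have hCG := hC G₀ hG'
  have hn0 : 0 < n := hn
  haveI : Nonempty (Fin 3 → Fin n) := ⟨fun _ => ⟨0, hn0⟩⟩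
  have hF2 : MemLp F 2 volume := memLp_two_of_memSobolev_one_complexify hF1
  have hFi : Integrable F volume := hF2.integrable one_le_two
  -- frame non-degeneracy `c₀ = (1 − 3θW)²`
  have hc₀ : 0 < (1 - 3 * θW) ^ 2 := by nlinarith
  have hGc : ∀ k' : Fin 3 → ℤ, (1 - 3 * θW) ^ 2 * FunctionSpaces.Torus.freqNormSq k' ≤ ∑ a, Torus.twistFreq G₀ k' a ^ 2 :=
    fun k' => le_freqNormSq_twist hθW0 (by linarith) hG' k'
  -- carrier: grid invariance, boundedness; tensor ellipticity at some aspect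
  have hper : ∀ (j : Fin 3 → Fin n) t x, cellField W M hM ν hν.1 n t (x + (fun i => ((((j i : ℕ) : ℝ) / n : ℝ) : UnitAddCircle))) = cellField W M hM ν hν.1 n t x :=
    fun j t x => by unfold cellField; exact cell_add_grid _ hn0 j t x
  have hb : MemLp (FunctionSpaces.Torus.stLift (cellField W M hM ν hν.1 n)) ∞
      (volume.restrict (Ioo 0 T ×ˢ (univ : Set (EuclideanSpace ℝ (Fin 3))))) := by
    unfold cellField; exact memLp_top_stLift_cell _ n T
  have hwin' := hwin
  obtain ⟨lam, hlam, hA⟩ := hwin'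
  have hlam0 : 0 < lam := lt_of_lt_of_le one_pos hlam.1
  have hn' : (0:ℝ) < n := by exact_mod_cast hn0
  have hN : Torus.NearIso ((1 / (n:ℝ) ^ 2) • 𝔸) ((1 / (n:ℝ) ^ 2) * (ν * (lo / lam))) ((1 / (n:ℝ) ^ 2) * (ν * (hi * lam))) :=
    hA.smul (by positivity)
  have hlo' : 0 < (1 / (n:ℝ) ^ 2) * (ν * (lo / lam)) := by have := hν.1; positivity
  -- the projected solutions
  have hRu : ∀ c : Fin 3 → Fin n, Torus.IsWeakTensorPassiveVectorDistortedOn 0 T ((1 / (n:ℝ) ^ 2) • 𝔸) (cellField W M hM ν hν.1 n) (fun _ _ => G₀)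
      (fun x => ∑ j : Fin 3 → Fin n, (1 / (n:ℝ) ^ 3 * Real.cos (2 * Real.pi * (∑ i, ((fun i => ((c i : ℕ) : ℤ)) i : ℝ) * ((j i : ℕ) : ℝ)) / n)) • F (x + (fun i => ((((j i : ℕ) : ℝ) / n : ℝ) : UnitAddCircle))))
      (fun t x => ∑ j : Fin 3 → Fin n, (1 / (n:ℝ) ^ 3 * Real.cos (2 * Real.pi * (∑ i, ((fun i => ((c i : ℕ) : ℤ)) i : ℝ) * ((j i : ℕ) : ℝ)) / n)) • u t (x + (fun i => ((((j i : ℕ) : ℝ) / n : ℝ) : UnitAddCircle)))) :=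
    fun c => hu.sum_smul_translate_constFrame' (fun (j : Fin 3 → Fin n) (i : Fin 3) => ((((j i : ℕ) : ℝ) / n : ℝ) : UnitAddCircle)) ((fun j : Fin 3 → Fin n => 1 / (n:ℝ) ^ 3 * Real.cos (2 * Real.pi * (∑ i, ((fun i => ((c i : ℕ) : ℤ)) i : ℝ) * ((j i : ℕ) : ℝ)) / n))) hper hFi
  -- per-class bound, for a.e. `t`
  have hclass : ∀ c : Fin 3 → Fin n, ∀ᵐ t ∂(volume.restrict (Ioo 0 T)),
      ∫ x, ‖∑ j : Fin 3 → Fin n, (1 / (n:ℝ) ^ 3 * Real.cos (2 * Real.pi * (∑ i, ((fun i => ((c i : ℕ) : ℤ)) i : ℝ) * ((j i : ℕ) : ℝ)) / n)) • u t (x + (fun i => ((((j i : ℕ) : ℝ) / n : ℝ) : UnitAddCircle)))‖ ^ 2 ≤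
        CK * Real.exp (-(2 * cK * ν * t)) * ∫ x, ‖∑ j : Fin 3 → Fin n, (1 / (n:ℝ) ^ 3 * Real.cos (2 * Real.pi * (∑ i, ((fun i => ((c i : ℕ) : ℤ)) i : ℝ) * ((j i : ℕ) : ℝ)) / n)) • F (x + (fun i => ((((j i : ℕ) : ℝ) / n : ℝ) : UnitAddCircle)))‖ ^ 2 := by
    intro c
    by_cases hfar : ∀ z : Fin 3 → ℤ, L ≤ ‖Torus.latticeVec ((fun i => ((c i : ℕ) : ℤ)) + (n:ℤ) • z)‖
    · -- far class: the per-class clause at the frame `G₀`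
      exact hCG ν hν n hn 𝔸 hodd hwin L hL hKL ((fun i => ((c i : ℕ) : ℤ))) hfar trivial _
        (memSobolev_pairProj hn0 ((fun i => ((c i : ℕ) : ℤ))) hF1) (hasZeroMean_pairProj ((fun i => ((c i : ℕ) : ℤ))) hFi hF0)
        (isWeaklyDivFree_distort_pairProj hn0 G₀ ((fun i => ((c i : ℕ) : ℤ))) hFi hFdiv)
        (fun k' h1 h2 => modeCoeff_pairProj_eq_zero_off hn0 ((fun i => ((c i : ℕ) : ℤ))) hFi k' h1 h2) T hT _ (hRu c)
    · -- near class: no datum, hence no solution (constant-frame uniqueness)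
      push Not at hfar
      obtain ⟨z, hz⟩ := hfar
      have h0 : (fun x => ∑ j : Fin 3 → Fin n, (1 / (n:ℝ) ^ 3 * Real.cos (2 * Real.pi * (∑ i, ((fun i => ((c i : ℕ) : ℤ)) i : ℝ) * ((j i : ℕ) : ℝ)) / n)) • F (x + (fun i => ((((j i : ℕ) : ℝ) / n : ℝ) : UnitAddCircle)))) =ᵐ[volume] 0 :=
        pairProj_ae_eq_zero_of_near hn0 ((fun i => ((c i : ℕ) : ℤ))) hFi hsupp ⟨z, hz⟩
      have hzero := ((hRu c).of_ae_eq_datum_dist h0).ae_eq_zero_of_memLp_top_constFrame hN hlo' hc₀ hGc hb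
      filter_upwards [hzero] with t ht
      have e1 : ∫ x, ‖∑ j : Fin 3 → Fin n, (1 / (n:ℝ) ^ 3 * Real.cos (2 * Real.pi * (∑ i, ((fun i => ((c i : ℕ) : ℤ)) i : ℝ) * ((j i : ℕ) : ℝ)) / n)) • u t (x + (fun i => ((((j i : ℕ) : ℝ) / n : ℝ) : UnitAddCircle)))‖ ^ 2 = 0 := by
        have hae : (fun x => ‖∑ j : Fin 3 → Fin n, (1 / (n:ℝ) ^ 3 * Real.cos (2 * Real.pi * (∑ i, ((fun i => ((c i : ℕ) : ℤ)) i : ℝ) * ((j i : ℕ) : ℝ)) / n)) • u t (x + (fun i => ((((j i : ℕ) : ℝ) / n : ℝ) : UnitAddCircle)))‖ ^ 2) =ᵐ[volume] fun _ => (0:ℝ) := by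
          filter_upwards [ht] with x hx
          have hx' : ∑ j : Fin 3 → Fin n, (1 / (n:ℝ) ^ 3 * Real.cos (2 * Real.pi * (∑ i, ((fun i => ((c i : ℕ) : ℤ)) i : ℝ) * ((j i : ℕ) : ℝ)) / n)) • u t (x + (fun i => ((((j i : ℕ) : ℝ) / n : ℝ) : UnitAddCircle))) = 0 := hx
          rw [hx', norm_zero, zero_pow two_ne_zero]
        rw [integral_congr_ae hae, integral_zero]
      have e2 : ∫ x, ‖∑ j : Fin 3 → Fin n, (1 / (n:ℝ) ^ 3 * Real.cos (2 * Real.pi * (∑ i, ((fun i => ((c i : ℕ) : ℤ)) i : ℝ) * ((j i : ℕ) : ℝ)) / n)) • F (x + (fun i => ((((j i : ℕ) : ℝ) / n : ℝ) : UnitAddCircle)))‖ ^ 2 = 0 := by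
        have hae : (fun x => ‖∑ j : Fin 3 → Fin n, (1 / (n:ℝ) ^ 3 * Real.cos (2 * Real.pi * (∑ i, ((fun i => ((c i : ℕ) : ℤ)) i : ℝ) * ((j i : ℕ) : ℝ)) / n)) • F (x + (fun i => ((((j i : ℕ) : ℝ) / n : ℝ) : UnitAddCircle)))‖ ^ 2) =ᵐ[volume] fun _ => (0:ℝ) := by
          filter_upwards [h0] with x hx
          have hx' : ∑ j : Fin 3 → Fin n, (1 / (n:ℝ) ^ 3 * Real.cos (2 * Real.pi * (∑ i, ((fun i => ((c i : ℕ) : ℤ)) i : ℝ) * ((j i : ℕ) : ℝ)) / n)) • F (x + (fun i => ((((j i : ℕ) : ℝ) / n : ℝ) : UnitAddCircle))) = 0 := hx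
          rw [hx', norm_zero, zero_pow two_ne_zero]
        rw [integral_congr_ae hae, integral_zero]
      rw [e1, e2, mul_zero]
  -- assembly over the classes by Parseval
  have hall := (ae_all_iff).2 hclass
  filter_upwards [hall, hu.ae_memLp_two, ae_restrict_mem measurableSet_Ioo] with t ht hut htI
  rw [integral_norm_sq_eq_sum_classes hn0 hut, integral_norm_sq_eq_sum_classes hn0 hF2, Finset.mul_sum]
  refine Finset.sum_le_sum fun c _ => ?_
  have hβ : 0 ≤ (if ∀ i, (n:ℤ) ∣ 2 * ((c i : ℕ) : ℤ) then (1:ℝ) else 2) := by split_ifs <;> norm_num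
  calc (if ∀ i, (n:ℤ) ∣ 2 * ((c i : ℕ) : ℤ) then (1:ℝ) else 2) * ∫ x, ‖∑ j : Fin 3 → Fin n, (1 / (n:ℝ) ^ 3 * Real.cos (2 * Real.pi * (∑ i, ((fun i => ((c i : ℕ) : ℤ)) i : ℝ) * ((j i : ℕ) : ℝ)) / n)) • u t (x + (fun i => ((((j i : ℕ) : ℝ) / n : ℝ) : UnitAddCircle)))‖ ^ 2
      ≤ (if ∀ i, (n:ℤ) ∣ 2 * ((c i : ℕ) : ℤ) then (1:ℝ) else 2) * (CK * Real.exp (-(2 * cK * ν * t)) * ∫ x, ‖∑ j : Fin 3 → Fin n, (1 / (n:ℝ) ^ 3 * Real.cos (2 * Real.pi * (∑ i, ((fun i => ((c i : ℕ) : ℤ)) i : ℝ) * ((j i : ℕ) : ℝ)) / n)) • F (x + (fun i => ((((j i : ℕ) : ℝ) / n : ℝ) : UnitAddCircle)))‖ ^ 2) :=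
        mul_le_mul_of_nonneg_left (ht c) hβ
    _ = CK * Real.exp (-(2 * cK * ν * t)) *
        ((if ∀ i, (n:ℤ) ∣ 2 * ((c i : ℕ) : ℤ) then (1:ℝ) else 2) * ∫ x, ‖∑ j : Fin 3 → Fin n, (1 / (n:ℝ) ^ 3 * Real.cos (2 * Real.pi * (∑ i, ((fun i => ((c i : ℕ) : ℤ)) i : ℝ) * ((j i : ℕ) : ℝ)) / n)) • F (x + (fun i => ((((j i : ℕ) : ℝ) / n : ℝ) : UnitAddCircle)))‖ ^ 2) := by ring

end Summit.AnomalousDissipation.AnomalousDissipation.Theorems.SolenoidalFractalHomogenisation.LagrangianStep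

end
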